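import Literature.MathematicalPhysics.QuantumLattice.HubbardNNNHoppingLocalHamiltonian
import Literature.MathematicalPhysics.QuantumLattice.HubbardNNNHoppingOpenClusters
import Literature.MathematicalPhysics.QuantumLattice.HubbardNNNHoppingRectSymmetries
import Literature.MathematicalPhysics.QuantumLattice.HubbardFermionInteractionLocalHamiltonian
import Literature.MathematicalPhysics.QuantumLattice.HubbardOpenBoxVersusTorus
import Literature.MathematicalPhysics.QuantumLattice.HubbardStateSectorDecomposition
import Literature.MathematicalPhysics.QuantumLattice.HubbardNNNHoppingClusterEmbedding
import Literature.MathematicalPhysics.QuantumLattice.HubbardGroundStateDoublonBound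
import HarnessLib

/-!
# The free-boundary `t–t'` box Hamiltonian of the square lattice: graph form, open-cluster form,
# sector bounds

Topic `Literature/MathematicalPhysics/QuantumLattice`. Companion of
`HubbardFermionInteractionLocalHamiltonian.lean` (`H^{t,U}_Λ = hamiltonian (polyGraph Λ) t U`) for the
diagonal part of the `t–t'` interaction `hubbardTTPrimeFermionInteraction t t' U`
(`HubbardNNNHoppingInteraction.lean`), and of `HubbardOpenBoxVersusTorus.lean` /
`HubbardNNNHoppingOpenClusters.lean`: the local (free-boundary) Hamiltonian
`H^{tt'}_Λ = Σ_{X ⊆ Λ} Φ(X)` of the `t–t'` model on a finite region `Λ ⊆ ℤ²` is a two-graph Hubbard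
Hamiltonian, and on the boxes `[0,ℓ)²` it is (isomorphic to) the open-cluster Hamiltonian
`hubbardOpenBoxTT' ℓ ℓ t t' U` of LeBlanc et al. (2015) eq. (1), so that its sector ground energies
bound the thermodynamic energy density `energyDensityTT'` from above EXACTLY
(`energyDensityTT'_le_openBox`). Everything is PROVED; no definition, no named fact.

* `diagHoppingFermionInteraction_localHamiltonian_eq_hamiltonian` — `H^{t'}_Λ = hamiltonian G' t' 0`
  for every graph `G'` on the sites of `Λ` whose adjacency is the diagonal adjacency `y = x ± (e₁ ± e₂)`.
* `hubbardTTPrime_localHamiltonian_eq_twoGraph` — `H^{tt'}_Λ = hamiltonian (polyGraph Λ) t U + hamiltonian G' t' 0`.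
* `groundEnergy_hubbardTTPrime_localHamiltonian_halfOpenBox` — on `[0,ℓ)²` the sector ground energies are
  those of `hubbardOpenBoxTT' ℓ ℓ t t' U` (graph isomorphism, `groundEnergy_hamiltonian_add_eq_of_iso`).
* `sq_mul_energyDensityTT'_le_groundEnergy_localHamiltonian` — `ℓ² e(N/ℓ²) ≤ E_{[0,ℓ)²}(N)`, `N < 2ℓ²`.
* `groundEnergy_twoGraph_full_ge` / `groundEnergy_twoGraph_full_sub_one_le` — the filled band and one hole:
  `E(2|Λ|) ≥ U|Λ|` and `E(2|Λ| - 1) ≤ U(|Λ| - 1)` (diagonal energies of occupation-basis states).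
* `InfVolFermionState.sum_re_expect_numberProj_mul_groundEnergy_le` — the sector decomposition of the
  energy of a state for an arbitrary particle-number-conserving Hermitian `H` (the `hamiltonian G t U`
  case is `sum_re_expect_numberProj_mul_groundEnergyAt_le`).

References: Ruelle (1969) §2.4, §3.3; LeBlanc et al., PRX 5 (2015) 041041, eq. (1).
-/

noncomputable section

namespace Literature.MathematicalPhysics.QuantumLattice

open Matrix Finset HubbardWave0 Literature.Probability.LatticeModels ThermodynamicLimit
open scoped ComplexOrder BigOperators

/-! ### The diagonal local Hamiltonian is a graph Hamiltonian -/

section DiagLocal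

variable (t' : ℝ)

/-- **The local Hamiltonian of the diagonal hopping interaction is the hopping Hamiltonian of the
induced diagonal graph**: if `G'` is a graph on the sites of `Λ ⊆ ℤ²` with `a ∼ b` iff `b = a ± j_s`
(`j_s = e₁ ± e₂`), then `Σ_{X ⊆ Λ} Φ^{t'}(X) = hamiltonian G' t' 0` (hopping `t'` along every diagonal bond
inside `Λ`, no on-site term). LeBlanc et al. (2015) eq. (1) restricted to a cluster.
[cite: LeBlancEtAl2015, eq. (1)] -/
theorem diagHoppingFermionInteraction_localHamiltonian_eq_hamiltonian (Λ : Finset (Site 2))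
    (G' : SimpleGraph (PolySite Λ)) [DecidableRel G'.Adj]
    (hG' : ∀ a b : PolySite Λ, G'.Adj a b ↔
      ((∃ s : Fin 2, ofLex b.1 = ofLex a.1 + diagVec s) ∨ ∃ s : Fin 2, ofLex a.1 = ofLex b.1 + diagVec s)) :
    (diagHoppingFermionInteraction t').localHamiltonian Λ = hamiltonian G' t' 0 := by
  classical
  set hop : {x // x ∈ Λ} → {x // x ∈ Λ} → FermionOp Λ := fun x y =>
    ∑ σ : Fin 2, creation (orb (PolySite.pt x.1 x.2) σ) * annihilation (orb (PolySite.pt y.1 y.2) σ) with hhop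
  -- (1) the graph Hamiltonian over `Λ.attach` (the on-site term has coefficient `U = 0`)
  have hR : hamiltonian G' t' 0 =
      -(t' : ℂ) • ∑ x ∈ Λ.attach, ∑ y ∈ Λ.attach,
        (if ((∃ s : Fin 2, y.1 = x.1 + diagVec s) ∨ ∃ s : Fin 2, x.1 = y.1 + diagVec s) then hop x y else 0) := by
    let e : PolySite Λ ≃ {x // x ∈ Λ} :=
      ⟨fun a => ⟨ofLex a.1, PolySite.ofLex_mem a⟩, fun x => PolySite.pt x.1 x.2, fun a => PolySite.pt_ofLex a,
        fun x => Subtype.ext rfl⟩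
    have hsum : ∀ (f : PolySite Λ → FermionOp Λ), ∑ a, f a = ∑ x ∈ Λ.attach, f (PolySite.pt x.1 x.2) := by
      intro f
      rw [← Finset.univ_eq_attach]
      exact Fintype.sum_equiv e f (fun x => f (PolySite.pt x.1 x.2)) fun a => by
        rw [show PolySite.pt (e a).1 (e a).2 = e.symm (e a) from rfl, Equiv.symm_apply_apply]
    rw [hamiltonian, hsum, hsum, Complex.ofReal_zero, zero_smul, add_zero]
    congr 1
    refine Finset.sum_congr rfl fun x _ => ?_
    rw [hsum]
    refine Finset.sum_congr rfl fun y _ => ?_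
    have hadj : G'.Adj (PolySite.pt x.1 x.2) (PolySite.pt y.1 y.2) ↔
        ((∃ s : Fin 2, y.1 = x.1 + diagVec s) ∨ ∃ s : Fin 2, x.1 = y.1 + diagVec s) := by
      rw [hG', PolySite.ofLex_coe_pt, PolySite.ofLex_coe_pt]
    by_cases h : (∃ s : Fin 2, y.1 = x.1 + diagVec s) ∨ ∃ s : Fin 2, x.1 = y.1 + diagVec s
    · rw [if_pos h]
      exact Finset.sum_congr rfl fun σ _ => if_pos (hadj.2 h)
    · rw [if_neg h]
      exact Finset.sum_eq_zero fun σ _ => if_neg fun h' => h (hadj.1 h')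
  -- (2) the hopping double sum as a sum over the diagonal bonds of `Λ`
  have hhopsum : ∑ x ∈ Λ.attach, ∑ y ∈ Λ.attach,
      (if ((∃ s : Fin 2, y.1 = x.1 + diagVec s) ∨ ∃ s : Fin 2, x.1 = y.1 + diagVec s) then hop x y else 0) =
      ∑ s : Fin 2, ∑ x ∈ Λ.attach,
        if h : x.1 + diagVec s ∈ Λ then hop x ⟨x.1 + diagVec s, h⟩ + hop ⟨x.1 + diagVec s, h⟩ x else 0 := by
    simp_rw [ite_diagAdj_eq_sum]
    have hswap : ∀ x : {x // x ∈ Λ},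
        ∑ y ∈ Λ.attach, ∑ s : Fin 2, ((if y.1 = x.1 + diagVec s then hop x y else 0) +
            (if x.1 = y.1 + diagVec s then hop x y else 0)) =
          ∑ s : Fin 2, ∑ y ∈ Λ.attach, ((if y.1 = x.1 + diagVec s then hop x y else 0) +
            (if x.1 = y.1 + diagVec s then hop x y else 0)) := fun x => Finset.sum_comm
    simp_rw [hswap]
    rw [Finset.sum_comm]
    refine Finset.sum_congr rfl fun s _ => ?_
    simp only [Finset.sum_add_distrib]
    have h1 : ∀ x : {x // x ∈ Λ}, ∑ y ∈ Λ.attach, (if y.1 = x.1 + diagVec s then hop x y else 0) =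
        if h : x.1 + diagVec s ∈ Λ then hop x ⟨x.1 + diagVec s, h⟩ else 0 := fun x =>
      sum_attach_ite_eq Λ (x.1 + diagVec s) (fun y => hop x y)
    have h2 : ∑ x ∈ Λ.attach, ∑ y ∈ Λ.attach, (if x.1 = y.1 + diagVec s then hop x y else 0) =
        ∑ y ∈ Λ.attach, if h : y.1 + diagVec s ∈ Λ then hop ⟨y.1 + diagVec s, h⟩ y else 0 := by
      rw [Finset.sum_comm]
      exact Finset.sum_congr rfl fun y _ => sum_attach_ite_eq Λ (y.1 + diagVec s) (fun x => hop x y)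
    simp_rw [h1]
    rw [h2, ← Finset.sum_add_distrib]
    refine Finset.sum_congr rfl fun x _ => ?_
    by_cases h : x.1 + diagVec s ∈ Λ
    · rw [dif_pos h, dif_pos h, dif_pos h]
    · rw [dif_neg h, dif_neg h, dif_neg h, add_zero]
  -- (3) the local Hamiltonian over diagonal bonds
  rw [FermionInteraction.localHamiltonian_eq_sum,
    sum_powerset_eq_of_diag_support Λ _ (fun X hX => by
      by_cases h : X ⊆ Λ
      · rw [dif_pos h, diagHoppingFermionInteraction_apply_eq_zero t' hX, map_zero]
      · rw [dif_neg h]),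
    hR, hhopsum]
  rw [Finset.sum_filter, Finset.sum_product, ← Finset.sum_attach Λ, Finset.sum_comm, Finset.smul_sum]
  refine Finset.sum_congr rfl fun s _ => ?_
  rw [Finset.smul_sum]
  refine Finset.sum_congr rfl fun x _ => ?_
  by_cases h : x.1 + diagVec s ∈ Λ
  · have hsub : ({x.1, x.1 + diagVec s} : Finset (Site 2)) ⊆ Λ := insert_subset x.2 (singleton_subset_iff.2 h)
    rw [if_pos h, dif_pos h, dif_pos hsub, diagHoppingFermionInteraction_apply_pair, fermionEmbed_smul,
      fermionEmbed_sum, hhop]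
    simp only [← Finset.sum_add_distrib]
    congr 1
    refine Finset.sum_congr rfl fun σ _ => ?_
    rw [fermionEmbed_add, fermionEmbed_mul, fermionEmbed_mul, fermionEmbed_conjTranspose,
      fermionEmbed_conjTranspose, fermionEmbed_incl_cAt, fermionEmbed_incl_cAt, cAt, cAt,
      annihilation_conjTranspose, annihilation_conjTranspose]
  · rw [if_neg h, dif_neg h, smul_zero]

/-- **The `t–t'` local Hamiltonian is a two-graph Hubbard Hamiltonian**:
`H^{tt'}_Λ = hamiltonian (polyGraph Λ) t U + hamiltonian G' t' 0` for every graph `G'` on the sites of `Λ`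
realising the diagonal adjacency. [cite: LeBlancEtAl2015, eq. (1)] -/
theorem hubbardTTPrime_localHamiltonian_eq_twoGraph (t U : ℝ) (Λ : Finset (Site 2))
    (G' : SimpleGraph (PolySite Λ)) [DecidableRel G'.Adj]
    (hG' : ∀ a b : PolySite Λ, G'.Adj a b ↔
      ((∃ s : Fin 2, ofLex b.1 = ofLex a.1 + diagVec s) ∨ ∃ s : Fin 2, ofLex a.1 = ofLex b.1 + diagVec s)) :
    (hubbardTTPrimeFermionInteraction t t' U).localHamiltonian Λ =
      hamiltonian (polyGraph Λ) t U + hamiltonian G' t' 0 := by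
  rw [hubbardTTPrimeFermionInteraction_localHamiltonian, hubbardFermionInteraction_localHamiltonian,
    diagHoppingFermionInteraction_localHamiltonian_eq_hamiltonian t' Λ G' hG']

end DiagLocal

/-! ### The box `[0,ℓ)²`: the local `t–t'` Hamiltonian is the open-cluster Hamiltonian -/

section Box

variable {ℓ : ℕ}

/-- Equality of sites of `ℤ²` is equality of both coordinates. [folklore] -/
private theorem site_two_eq_iff (x y : Site 2) : x = y ↔ x 0 = y 0 ∧ x 1 = y 1 := by
  refine ⟨fun h => ⟨by rw [h], by rw [h]⟩, fun h => funext fun i => ?_⟩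
  rcases fin_two_eq_zero_or_one i with rfl | rfl
  exacts [h.1, h.2]

/-- Nearest-neighbour adjacency of `ℤ²` in coordinates. [folklore] -/
private theorem zdGraph_two_adj_iff (x y : Site 2) : (zdGraph 2).Adj x y ↔
    ((y 0 = x 0 + 1 ∧ y 1 = x 1) ∨ (y 0 = x 0 ∧ y 1 = x 1 + 1)) ∨
      ((x 0 = y 0 + 1 ∧ x 1 = y 1) ∨ (x 0 = y 0 ∧ x 1 = y 1 + 1)) := by
  have h10 : (1 : Fin 2) ≠ 0 := by decide
  have h01 : (0 : Fin 2) ≠ 1 := by decide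
  rw [zdGraph_adj_iff, Fin.exists_fin_two]
  simp only [site_two_eq_iff, Pi.add_apply, Pi.single_eq_same, Pi.single_eq_of_ne h10,
    Pi.single_eq_of_ne h01, add_zero]
  tauto

/-- Diagonal adjacency of `ℤ²` in coordinates. [folklore] -/
private theorem diagAdj_iff (x y : Site 2) :
    ((∃ s : Fin 2, y = x + diagVec s) ∨ ∃ s : Fin 2, x = y + diagVec s) ↔
      (y 0 = x 0 + 1 ∧ (y 1 = x 1 + 1 ∨ y 1 = x 1 + -1)) ∨
        (x 0 = y 0 + 1 ∧ (x 1 = y 1 + 1 ∨ x 1 = y 1 + -1)) := by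
  have h10 : (1 : Fin 2) ≠ 0 := by decide
  rw [Fin.exists_fin_two, Fin.exists_fin_two]
  simp only [site_two_eq_iff, Pi.add_apply, diagVec_apply_zero, diagVec_apply_one, if_neg h10]
  tauto

variable (f : PolySite (halfOpenBox 2 ℓ) ≃ Fin ℓ ×ₗ Fin ℓ)
  (hf0 : ∀ a, (((ofLex (f a)).1 : ℕ) : ℤ) = ofLex a.1 0) (hf1 : ∀ a, (((ofLex (f a)).2 : ℕ) : ℤ) = ofLex a.1 1)

include hf0 hf1

/-- **Box bonds are open-cluster bonds**: under the coordinate bijection `[0,ℓ)² ≃ Fin ℓ ×ₗ Fin ℓ`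
the induced nearest-neighbour graph of the box is the open-cluster graph `rectBoxGraph ℓ ℓ` (the
nearest-neighbour bonds `⟨i, j⟩` of LeBlanc et al. (2015) eq. (1) inside an open cluster).
[cite: LeBlancEtAl2015, eq. (1)] -/
theorem rectBoxGraph_adj_iff_polyGraph_adj (a b : PolySite (halfOpenBox 2 ℓ)) :
    (rectBoxGraph ℓ ℓ).Adj (f a) (f b) ↔ (polyGraph (halfOpenBox 2 ℓ)).Adj a b := by
  rw [polyGraph_adj, zdGraph_two_adj_iff, ← hf0 a, ← hf0 b, ← hf1 a, ← hf1 b]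
  simp only [rectBoxGraph, lineAdj, Fin.ext_iff]
  omega

/-- **Diagonal box bonds are the open-cluster diagonal bonds**: under the coordinate bijection the
diagonal adjacency `y = x ± (e₁ ± e₂)` of the box is `rectBoxDiagGraph ℓ ℓ` (the next-nearest-neighbour
bonds `⟨⟨i, j⟩⟩` of LeBlanc et al. (2015) eq. (1) inside an open cluster). [cite: LeBlancEtAl2015, eq. (1)] -/
theorem rectBoxDiagGraph_adj_iff_diagAdj (a b : PolySite (halfOpenBox 2 ℓ)) :
    (rectBoxDiagGraph ℓ ℓ).Adj (f a) (f b) ↔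
      ((∃ s : Fin 2, ofLex b.1 = ofLex a.1 + diagVec s) ∨ ∃ s : Fin 2, ofLex a.1 = ofLex b.1 + diagVec s) := by
  rw [diagAdj_iff, ← hf0 a, ← hf0 b, ← hf1 a, ← hf1 b]
  simp only [rectBoxDiagGraph, lineAdj]
  omega

omit hf0 hf1

/-- **On the box `[0,ℓ)²` the `t–t'` local Hamiltonian has the sector ground energies of the
open-cluster Hamiltonian `hubbardOpenBoxTT' ℓ ℓ t t' U`** (LeBlanc et al. (2015) eq. (1) on the
`ℓ × ℓ` cluster with open boundary conditions; graph-isomorphism invariance of the sector energies).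
[cite: LeBlancEtAl2015, eq. (1)] -/
theorem groundEnergy_hubbardTTPrime_localHamiltonian_halfOpenBox (t t' U : ℝ) (ℓ N : ℕ) :
    groundEnergy ((hubbardTTPrimeFermionInteraction t t' U).localHamiltonian (halfOpenBox 2 ℓ)) N =
      groundEnergy (hubbardOpenBoxTT' ℓ ℓ t t' U) N := by
  classical
  obtain ⟨f, hf0, hf1⟩ := exists_equiv_polySite_halfOpenBox_two ℓ
  rw [hubbardTTPrime_localHamiltonian_eq_twoGraph t' t U (halfOpenBox 2 ℓ) ((rectBoxDiagGraph ℓ ℓ).comap f)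
      (fun a b => rectBoxDiagGraph_adj_iff_diagAdj f hf0 hf1 a b), hubbardOpenBoxTT',
    groundEnergy_hamiltonian_add_eq_of_iso (polyGraph (halfOpenBox 2 ℓ)) ((rectBoxDiagGraph ℓ ℓ).comap f)
      (rectBoxGraph ℓ ℓ) (rectBoxDiagGraph ℓ ℓ) f (rectBoxGraph_adj_iff_polyGraph_adj f hf0 hf1)
      (fun _ _ => Iff.rfl) t U t' 0 N]

/-- **The thermodynamic `t–t'` energy density minorises every box sector below the filled band,
exactly**: `ℓ² · e(t,t',U; N/ℓ²) ≤ E_{[0,ℓ)²}(N)` for `U ≥ 0`, `ℓ ≥ 1`, `N < 2ℓ²`, the box energy being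
the sector ground energy of the free-boundary local Hamiltonian `Σ_{X ⊆ [0,ℓ)²} Φ^{tt'}(X)`
(tile large tori by open clusters, `energyDensityTT'_le_openBox`). [cite: Ruelle1969, §3.3] -/
theorem sq_mul_energyDensityTT'_le_groundEnergy_localHamiltonian (t t' : ℝ) {U : ℝ} (hU : 0 ≤ U)
    (hℓ : 1 ≤ ℓ) {N : ℕ} (hN : N < 2 * (ℓ * ℓ)) :
    (ℓ : ℝ) ^ 2 * energyDensityTT' t t' U ((N : ℝ) / (ℓ : ℝ) ^ 2) ≤
      groundEnergy ((hubbardTTPrimeFermionInteraction t t' U).localHamiltonian (halfOpenBox 2 ℓ)) N := by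
  have hℓpos : (0 : ℝ) < ℓ := by exact_mod_cast hℓ
  have hℓ2 : (0 : ℝ) < (ℓ : ℝ) * (ℓ : ℝ) := by positivity
  have h := energyDensityTT'_le_openBox t t' hU hℓ hℓ hN
  rw [groundEnergy_hubbardTTPrime_localHamiltonian_halfOpenBox, sq]
  rw [le_div_iff₀ hℓ2] at h
  linarith

end Box

/-! ### Occupation-basis energies: the filled band and one hole -/

section BasisEnergies

variable {Λ : Type*} [LinearOrder Λ] [Fintype Λ]

/-- The hopping part has no diagonal entries, so the diagonal entry of `hamiltonian G t U` at a
configuration `s` is `U · #(doubly occupied sites of s)` (Tasaki 1998 §5.1). [folklore] -/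
private theorem hamiltonian_apply_self (G : SimpleGraph Λ) [DecidableRel G.Adj] (t U : ℝ) (s : Finset (Orb Λ)) :
    hamiltonian G t U s s = (U : ℂ) * ((doublyOccupied s).card : ℂ) := by
  have hsplit : hamiltonian G t U = hamiltonian G t 0 + (U : ℂ) • ∑ x : Λ, numberOp x 0 * numberOp x 1 := by
    simp only [hamiltonian, Complex.ofReal_zero, zero_smul, add_zero]
  have hhop : hamiltonian G t 0 s s = 0 := by
    unfold hamiltonian
    simp only [Matrix.add_apply, Matrix.smul_apply, Matrix.sum_apply, Complex.ofReal_zero, zero_smul,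
      Matrix.zero_apply, add_zero]
    rw [Finset.sum_eq_zero fun x _ => Finset.sum_eq_zero fun y _ => Finset.sum_eq_zero fun σ _ => ?_]
    · simp
    · split_ifs with hxy
      · exact creation_mul_annihilation_apply_self_eq_zero (fun h => G.ne_of_adj hxy (orb_inj.1 h).1) _
      · rfl
  rw [hsplit, Matrix.add_apply, hhop, zero_add, Matrix.smul_apply, sum_numberOp_mul_numberOp_eq_diagonal,
    @Matrix.diagonal_apply_eq _ _ (_), smul_eq_mul]

/-- The diagonal entry of a two-graph Hamiltonian `H_{G₁}(t,U) + H_{G₂}(t',U')` at a configuration is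
`(U + U') · #(doubly occupied sites)`. [folklore] -/
private theorem hamiltonian_add_apply_self (G₁ G₂ : SimpleGraph Λ) [DecidableRel G₁.Adj] [DecidableRel G₂.Adj]
    (t U t' U' : ℝ) (s : Finset (Orb Λ)) :
    (hamiltonian G₁ t U + hamiltonian G₂ t' U') s s = ((U : ℂ) + (U' : ℂ)) * ((doublyOccupied s).card : ℂ) := by
  rw [Matrix.add_apply, hamiltonian_apply_self, hamiltonian_apply_self, add_mul]

/-- Every site of the full configuration is doubly occupied. [folklore] -/
private theorem doublyOccupied_univ : doublyOccupied (univ : Finset (Orb Λ)) = univ := by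
  ext x
  simp

/-- An occupation-basis vector `|s⟩` lies in the `#s`-particle sector. [folklore] -/
private theorem isNParticle_single_card {ι : Type*} [DecidableEq ι] [Fintype ι] (s : Finset ι) :
    IsNParticle s.card (Pi.single s (1 : ℂ) : Fock ι) := fun u hu => by
  rw [Pi.single_apply, if_neg]
  rintro rfl
  exact hu rfl

/-- `⟨s|s⟩ = 1`. [folklore] -/
private theorem star_single_dotProduct_single_one {ι : Type*} [DecidableEq ι] [Fintype ι] (s : Finset ι) :
    star (Pi.single s (1 : ℂ) : Fock ι) ⬝ᵥ Pi.single s 1 = 1 := by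
  rw [dotProduct_single, Pi.star_apply, Pi.single_eq_same, star_one, one_mul]

/-- **The energy of the configuration `|s⟩` bounds its sector from above**: `E_H(#s) ≤ Re H_{ss}`.
[folklore] -/
private theorem groundEnergy_card_le_re_apply_self {ι : Type*} [LinearOrder ι] [Fintype ι]
    (H : Matrix (Finset ι) (Finset ι) ℂ) (s : Finset ι) : groundEnergy H s.card ≤ (H s s).re := by
  have h := groundEnergy_le_re_expect H (isNParticle_single_card s) (star_single_dotProduct_single_one s)
  rwa [expect, Literature.Computability.AlgebraicComplexity.star_single_dotProduct_mulVec_single] at h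

/-- **The filled sector is one-dimensional**: every unit `|ι|`-particle vector is a phase times
`|univ⟩`, so `E_H(|ι|) = Re H_{univ,univ}`. [folklore] -/
private theorem groundEnergy_card_univ_eq {ι : Type*} [LinearOrder ι] [Fintype ι]
    (H : Matrix (Finset ι) (Finset ι) ℂ) : groundEnergy H (Fintype.card ι) = (H univ univ).re := by
  set e : Fock ι := Pi.single (univ : Finset ι) (1 : ℂ) with he
  have he1 : star e ⬝ᵥ e = 1 := star_single_dotProduct_single_one (univ : Finset ι)
  have heH : star e ⬝ᵥ (H *ᵥ e) = H univ univ :=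
    Literature.Computability.AlgebraicComplexity.star_single_dotProduct_mulVec_single H univ
  have hset : {E : ℝ | ∃ ψ : Fock ι, IsNParticle (Fintype.card ι) ψ ∧ star ψ ⬝ᵥ ψ = 1 ∧ E = (expect H ψ).re} =
      {(H univ univ).re} := by
    ext E
    simp only [Set.mem_setOf_eq, Set.mem_singleton_iff]
    constructor
    · rintro ⟨ψ, hψ, hψ1, rfl⟩
      have hφ : ψ = ψ univ • e := by
        funext s
        rw [Pi.smul_apply, he, Pi.single_apply, smul_eq_mul]
        by_cases hs : s = univ
        · subst hs; rw [if_pos rfl, mul_one]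
        · rw [if_neg hs, mul_zero, hψ s (fun h => hs ((Finset.card_eq_iff_eq_univ s).1 h))]
      have hcc : star (ψ univ) * ψ univ = 1 := by
        have h1 := hψ1
        rw [hφ, star_smul, smul_dotProduct, dotProduct_smul, smul_smul, he1, smul_eq_mul, mul_one] at h1
        exact h1
      rw [expect, hφ, star_smul, mulVec_smul, smul_dotProduct, dotProduct_smul, smul_smul, hcc, one_smul, heH]
    · rintro rfl
      refine ⟨e, ?_, he1, by rw [expect, heH]⟩
      have h := isNParticle_single_card (univ : Finset ι)
      rwa [Finset.card_univ] at h
  rw [groundEnergy, hset, csInf_singleton]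

variable (G₁ G₂ : SimpleGraph Λ) [DecidableRel G₁.Adj] [DecidableRel G₂.Adj]

/-- **The filled band of a two-graph Hubbard Hamiltonian**: `E(2|Λ|) = (U + U')|Λ|` for
`H = H_{G₁}(t,U) + H_{G₂}(t',U')` (the only `2|Λ|`-particle state is the fully occupied configuration,
an eigenvector on which every hopping term vanishes and every site is doubly occupied; Lieb (1989),
proof of Theorem 1, for the filled band). [cite: LiebPRL1989, proof of Theorem 1] -/
theorem groundEnergy_hamiltonian_add_full (t U t' U' : ℝ) :
    groundEnergy (hamiltonian G₁ t U + hamiltonian G₂ t' U') (2 * Fintype.card Λ) =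
      (U + U') * Fintype.card Λ := by
  classical
  rw [← card_orb, groundEnergy_card_univ_eq, hamiltonian_add_apply_self, doublyOccupied_univ, Finset.card_univ]
  rw [show ((U : ℂ) + (U' : ℂ)) * ((Fintype.card Λ : ℕ) : ℂ) = (((U + U') * Fintype.card Λ : ℝ) : ℂ) by
    push_cast; ring, Complex.ofReal_re]

/-- **One hole in the filled band**: `E(2|Λ| - 1) ≤ (U + U')(|Λ| - 1)` for a two-graph Hubbard
Hamiltonian on a nonempty lattice (trial configuration: all orbitals but one occupied, which has
`|Λ| - 1` doubly occupied sites and no diagonal hopping element). [cite: LiebPRL1989, proof of Theorem 1] -/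
theorem groundEnergy_hamiltonian_add_full_sub_one_le [Nonempty Λ] (t U t' U' : ℝ) :
    groundEnergy (hamiltonian G₁ t U + hamiltonian G₂ t' U') (2 * Fintype.card Λ - 1) ≤
      (U + U') * (Fintype.card Λ - 1) := by
  classical
  obtain ⟨x⟩ := ‹Nonempty Λ›
  set s : Finset (Orb Λ) := univ.erase (orb x 0) with hs
  have hcard : s.card = 2 * Fintype.card Λ - 1 := by
    rw [hs, Finset.card_erase_of_mem (Finset.mem_univ _), Finset.card_univ, card_orb]
  have hdocc : doublyOccupied s = univ.erase x := by
    ext y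
    rw [mem_doublyOccupied, hs, Finset.mem_erase, Finset.mem_erase, Finset.mem_erase]
    simp only [Finset.mem_univ, and_true, ne_eq, orb_inj]
    by_cases hy : y = x
    · subst hy; simp
    · simp [hy]
  have h := groundEnergy_card_le_re_apply_self (hamiltonian G₁ t U + hamiltonian G₂ t' U') s
  rw [hcard, hamiltonian_add_apply_self, hdocc, Finset.card_erase_of_mem (Finset.mem_univ x), Finset.card_univ,
    show ((U : ℂ) + (U' : ℂ)) * (((Fintype.card Λ - 1 : ℕ)) : ℂ) = (((U + U') * ((Fintype.card Λ - 1 : ℕ) : ℝ) : ℝ) : ℂ) by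
      push_cast; ring, Complex.ofReal_re, Nat.cast_sub Fintype.card_pos, Nat.cast_one] at h
  exact h

end BasisEnergies

/-! ### The sector decomposition of the energy of a state, for a general number-conserving `H` -/

section Sector

variable {Λ : Type*} [LinearOrder Λ] [Fintype Λ]

/-- **`H - Σ_N E_H(N) P_N` is positive semidefinite** for every Hermitian `H` commuting with the
particle number (`N` over all sectors `0, …, 2|Λ|`): on the `N`-particle sector `H` is bounded below by
its sector ground energy. Ruelle (1969) §2.4 (variational principle in finite volume). [cite: Ruelle1969, §2.4] -/
theorem posSemidef_sub_sum_groundEnergy_smul_numberProj (H : Matrix (Finset (Orb Λ)) (Finset (Orb Λ)) ℂ)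
    (hH : H.IsHermitian) (hHN : Commute H totalNumber) :
    (H - ∑ N ∈ range (Fintype.card (Orb Λ) + 1),
        ((groundEnergy H N : ℝ) : ℂ) • (numberProj N : Matrix (Finset (Orb Λ)) (Finset (Orb Λ)) ℂ)).PosSemidef := by
  set R := range (Fintype.card (Orb Λ) + 1) with hR
  have hherm : (H - ∑ N ∈ R, ((groundEnergy H N : ℝ) : ℂ) •
      (numberProj N : Matrix (Finset (Orb Λ)) (Finset (Orb Λ)) ℂ)).IsHermitian := by
    refine hH.sub ?_
    rw [Matrix.IsHermitian, conjTranspose_sum]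
    refine Finset.sum_congr rfl fun N _ => ?_
    rw [conjTranspose_smul, (numberProj_isHermitian N).eq, Complex.star_def, Complex.conj_ofReal]
  refine Matrix.PosSemidef.of_dotProduct_mulVec_nonneg hherm fun x => ?_
  have him := im_dotProduct_mulVec_self_of_isHermitian hherm x
  rw [Complex.nonneg_iff]
  refine ⟨?_, him.symm⟩
  have hdecomp : star x ⬝ᵥ (H *ᵥ x) = ∑ N ∈ R, star (numberProj N *ᵥ x) ⬝ᵥ (H *ᵥ (numberProj N *ᵥ x)) := by
    conv_lhs => rw [← sum_numberProj_mulVec x]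
    rw [star_sum, sum_dotProduct, mulVec_sum]
    refine Finset.sum_congr rfl fun N _ => ?_
    rw [dotProduct_sum]
    refine Finset.sum_eq_single N (fun M _ hMN => ?_) (fun h => absurd (by assumption) h)
    exact dotProduct_eq_zero_of_isNParticle_ne (isNParticle_numberProj_mulVec N x)
      (LiebTwo.isNParticle_mulVec_of_commute (isNParticle_numberProj_mulVec M x) hHN.symm.eq) (Ne.symm hMN)
  have hproj : ∀ N, star x ⬝ᵥ ((((groundEnergy H N : ℝ) : ℂ) •
      (numberProj N : Matrix (Finset (Orb Λ)) (Finset (Orb Λ)) ℂ)) *ᵥ x) =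
        ((groundEnergy H N : ℝ) : ℂ) * (star (numberProj N *ᵥ x) ⬝ᵥ (numberProj N *ᵥ x)) := fun N => by
    rw [smul_mulVec, dotProduct_smul, smul_eq_mul, dotProduct_numberProj_mulVec]
  rw [sub_mulVec, dotProduct_sub, hdecomp, Matrix.sum_mulVec, dotProduct_sum, Complex.sub_re, Complex.re_sum,
    Complex.re_sum, ← Finset.sum_sub_distrib]
  refine Finset.sum_nonneg fun N _ => ?_
  rw [hproj, Complex.re_ofReal_mul, sub_nonneg]
  exact re_dotProduct_mulVec_ge_groundEnergy H (isNParticle_numberProj_mulVec N x)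

end Sector

/-- **The energy of a state is at least the average of the sector ground energies over its number
distribution**, for every Hermitian particle-number-conserving `H` on the local algebra of a region
`Λ` (e.g. the `t–t'` local Hamiltonian): `Σ_{N ≤ 2|Λ|} Re ω(P_N) · E_H(N) ≤ Re ω(H)`.
Ruelle (1969) §2.4. [cite: Ruelle1969, §2.4] -/
theorem InfVolFermionState.sum_re_expect_numberProj_mul_groundEnergy_le {d : ℕ} (ω : InfVolFermionState d)
    (Λ : Finset (Site d)) (H : FermionOp Λ) (hH : H.IsHermitian) (hHN : Commute H totalNumber) :
    ∑ N ∈ range (Fintype.card (Orb (PolySite Λ)) + 1), (ω.expect Λ (numberProj N)).re * groundEnergy H N ≤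
      (ω.expect Λ H).re := by
  have h := ω.expect_re_nonneg_of_posSemidef Λ (posSemidef_sub_sum_groundEnergy_smul_numberProj H hH hHN)
  rw [map_sub, map_sum, Complex.sub_re, Complex.re_sum, sub_nonneg] at h
  refine le_of_eq_of_le ?_ h
  refine Finset.sum_congr rfl fun N _ => ?_
  rw [map_smul, smul_eq_mul, Complex.re_ofReal_mul, mul_comm]

/-- The `t–t'` local Hamiltonian of a region is Hermitian and conserves the particle number (it is a
two-graph Hubbard Hamiltonian). [cite: LeBlancEtAl2015, eq. (1)] -/
theorem hubbardTTPrime_localHamiltonian_isHermitian_and_commute (t t' U : ℝ) (Λ : Finset (Site 2)) :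
    ((hubbardTTPrimeFermionInteraction t t' U).localHamiltonian Λ).IsHermitian ∧
      Commute ((hubbardTTPrimeFermionInteraction t t' U).localHamiltonian Λ) totalNumber := by
  classical
  -- any graph realising the diagonal adjacency will do: take the adjacency itself
  let G' : SimpleGraph (PolySite Λ) :=
    { Adj := fun a b => (∃ s : Fin 2, ofLex b.1 = ofLex a.1 + diagVec s) ∨ ∃ s : Fin 2, ofLex a.1 = ofLex b.1 + diagVec s
      symm := ⟨fun _ _ h => Or.symm h⟩
      loopless := ⟨fun a h => by
        rcases h with ⟨s, hs⟩ | ⟨s, hs⟩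
        · exact self_ne_add_diagVec _ s hs
        · exact self_ne_add_diagVec _ s hs⟩ }
  haveI : DecidableRel G'.Adj := fun a b => inferInstanceAs (Decidable (_ ∨ _))
  rw [hubbardTTPrime_localHamiltonian_eq_twoGraph t' t U Λ G' (fun _ _ => Iff.rfl)]
  obtain ⟨h1, h1N, -⟩ := hamiltonian_isHermitian_and_commute_holds (polyGraph Λ) t U
  obtain ⟨h2, h2N, -⟩ := hamiltonian_isHermitian_and_commute_holds G' t' 0
  exact ⟨h1.add h2, h1N.add_left h2N⟩

end Literature.MathematicalPhysics.QuantumLattice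

end
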